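import Mathlib
import HarnessLib
import Summits.NavierStokesRegularity.NavierStokesRegularity.Theorems.PoloidalWindowDoorLrcModEntireShearedDifferenceRow
import Summits.NavierStokesRegularity.NavierStokesRegularity.Theorems.PoloidalWindowDoorLrcModEntireShearedTemplateCoeffs

/-!
# Route `PoloidalWindowDoor`, item `LrcModEntire` (stmt-NavierStokesRegularity-20428), cell (Q4-sonic, straight, μ < 0) `stub_Q4sonicLineNeg`, case I,
# PERIODIC branch — THE DIFFERENCE ROW IN TEMPLATE SHAPE `hR3`, AND ITS COEFFICIENTS ARE SMOOTH ON THE TUBE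

Cell ns-regularity-ideate, stub-worker seat ns-poloidal-K2-p2 g17 under the LEAD of item 20428 (ns-poloidal-K2-p3 g17; T2B-g17 §9/§10); `--supports
stmt-NavierStokesRegularity-20428 --as helper`.  The two pieces the LEAD's `…ShearedDifferenceRow.differenceRow_sheared` (P2b-ii) leaves to the periodic END
assembly (his 21:40Z plan: «normal form ÷(1−μ)² like `verticalRow_template` + α-smoothness like p743798»):

* ★ `differenceRow_template` — the sheared difference row SOLVED for `∂_m²ϑ` when `μ ≠ 1` on the parameter set: with `ν := 1 − μ(t,z)`, `Uᵃ := U(t, x+a)`,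
  `θ := U₂(t,·)`, `c_D := (μ_t − μ_zz) + (μ_z/2)(θ(x+a) + θ(x))`,
  `∂_m²ϑ = −∂_s²ϑ + (1/ν)∂_t′ϑ + ((νUᵃ₂ + 2μ_z)/ν²)∂_z′ϑ + (Uᵃ_e/ν)∂_sϑ + ((ν(Uᵃ_ν − d_t − Uᵃ₂d_z) − 2μ_zd_z)/ν²)∂_mϑ + ((νθ_z − c_D)/ν²)ϑ + (θ_e/ν)P_D + (θ_ν/ν)Q_D`
  — literally hypothesis `hR3` of `…CaseIPeriodicEnd.periodicEnd_of_verticalRow` (unknown written `(U q.1 (q.2 + a) − U q.1 q.2) 2`, the `θ`-derivatives as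
  components `(D(U t)(x)[w])₂`);
* ★ `difference_coeffs_smooth` — the seven coefficients are `C^∞` on the tube (`uncurry U ∈ C^∞(T × ℝ³)`, `uncurry μ ∈ C^∞(Dμ)` over `O`, `μ ≠ 1` on `O`,
  `d ∈ C^∞(D)`), by port-2's building blocks of `…ShearedTemplateCoeffs` plus `contDiffOn_Ua_comp` (components of the TRANSLATED profile at the sheared point).

WHAT THIS IS NOT: not a claim about Navier–Stokes regularity; bookkeeping for the periodic END of the v14 child of the research slot `stub_Q4sonicLineNeg`; no
registry stub is closed here; items 20428 / 19708 / 27893 OPEN (bears_on LADDER-NS N0).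
-/

noncomputable section

set_option linter.dupNamespace false
set_option linter.style.longLine false

namespace Summit.NavierStokesRegularity.NavierStokesRegularity.Theorems.PoloidalWindowDoorLrcModEntireShearedDifferenceTemplate

open Set Function Filter Topology Metric
open scoped RealInnerProductSpace InnerProductSpace ContDiff
open Literature.Analysis
open Summit.NavierStokesRegularity.NavierStokesRegularity.Theorems.LocalSineTubeDoorProfileAlignedWindowRigidityAncient
open Summit.NavierStokesRegularity.NavierStokesRegularity.Theorems.PoloidalWindowDoorPoloidalWindowRigidityWindow
open Summit.NavierStokesRegularity.NavierStokesRegularity.Theorems.PoloidalWindowDoorPoloidalWindowRigidityConstantShearSlice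
open Summit.NavierStokesRegularity.NavierStokesRegularity.Theorems.PoloidalWindowDoorLrcModEntireSheetSystemUniqueness
open Summit.NavierStokesRegularity.NavierStokesRegularity.Theorems.PoloidalWindowDoorLrcModEntireSheetFlattenTools
open Summit.NavierStokesRegularity.NavierStokesRegularity.Theorems.PoloidalWindowDoorLrcModEntireShearedCoordinates
open Summit.NavierStokesRegularity.NavierStokesRegularity.Theorems.PoloidalWindowDoorLrcModEntireShearedKinematics
open Summit.NavierStokesRegularity.NavierStokesRegularity.Theorems.PoloidalWindowDoorLrcModEntireShearedSecondOrder
open Summit.NavierStokesRegularity.NavierStokesRegularity.Theorems.PoloidalWindowDoorLrcModEntireShearedTemplateCoeffs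
open Summit.NavierStokesRegularity.NavierStokesRegularity.Theorems.PoloidalWindowDoorLrcModEntireShearedDifferenceRow
open Summit.NavierStokesRegularity.NavierStokesRegularity.Theorems.PoloidalWindowDoorLrcModEntireQ4SonicHotSheetJet

variable {C : ℝ} {U : ℝ → E3 → E3} {μ : ℝ → ℝ → ℝ} {ρ : ℝ} {e a : E3} {T : Set ℝ} {O : Set Y3} {D Dμ : Set (ℝ × ℝ)} {d : ℝ × ℝ → ℝ}

/-- The algebra of solving the sheared difference row for `∂_m²ϑ` (`ν = 1 − m ≠ 0`; all quantities real numbers). -/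
theorem solve_template {m T M S Z MM SS G P Q dt dz e0 e1 U0 U1 Ua2 U2 μt μz μzz θe θν θz : ℝ} (hν : 1 - m ≠ 0)
    (h : (1 - m) * ((T - dt * M) + ((U0 * e0 + U1 * e1) * S + (U1 * e0 - U0 * e1) * M + Ua2 * (Z - dz * M)) - (1 - m) * (MM + SS)
      + (P * θe + Q * θν + G * θz)) = (μt - μzz) * G + μz / 2 * (Ua2 + U2) * G - 2 * μz * (Z - dz * M)) :
    MM = (-1 : ℝ) * SS + (1 / (1 - m)) * T + (((1 - m) * Ua2 + 2 * μz) / (1 - m) ^ 2) * Z + ((U0 * e0 + U1 * e1) / (1 - m)) * S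
      + (((1 - m) * ((U1 * e0 - U0 * e1) - dt - Ua2 * dz) - 2 * μz * dz) / (1 - m) ^ 2) * M
      + (((1 - m) * θz - ((μt - μzz) + μz / 2 * (Ua2 + U2))) / (1 - m) ^ 2) * G + (θe / (1 - m)) * P + (θν / (1 - m)) * Q := by
  field_simp
  linear_combination (-2 : ℝ) * h

/-- ★ **THE DIFFERENCE ROW IN THE TEMPLATE SHAPE `hR3`** of `…CaseIPeriodicEnd.periodicEnd_of_verticalRow` / `…SheetSystemMixed.eq_zero_of_mixedSystem_template`:
the LEAD's `differenceRow_sheared` divided by `(1 − μ)²` and solved for `∂_m²ϑ` (see the module docstring for the coefficients). -/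
theorem differenceRow_template
    (hrate : FluidPDE.HasTypeITimeDecay C U) (hcont : ContinuousOn (uncurry U) (Iio (0 : ℝ) ×ˢ univ))
    (hmild : ∀ s t : ℝ, s < t → t < 0 → ∀ x, U t x = UnboundedOperators.heatExtension (U s) (t - s) x - FluidPDE.oseenDuhamel 1 s U U t x)
    (hdiv : ∀ t < 0, FluidPDE.VectorCalculus.IsDivFree (U t))
    (hpol : ∀ s < 0, ∀ y, ⟪FluidPDE.curl (U s) y, EuclideanSpace.single 2 1⟫_ℝ = 0)
    (hμ3 : ContDiff ℝ 3 (uncurry μ))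
    (hslabU : ∀ t : ℝ, |t + 1| < ρ → ∀ x : E3, |x 2| < ρ → ∀ b : Fin 3, b ≠ 2 →
      fderiv ℝ (U t) x (EuclideanSpace.single 2 1) b = μ t (x 2) * fderiv ℝ (U t) x (EuclideanSpace.single b 1) 2)
    (he2 : e 2 = 0) (hunit : e 0 ^ 2 + e 1 ^ 2 = 1) (ha : a 2 = 0)
    (hO : IsOpen O) (hOt : ∀ y ∈ O, y.1 < 0 ∧ |y.1 + 1| < ρ ∧ |y.2.2| < ρ) (hμ1 : ∀ y ∈ O, μ y.1 y.2.2 ≠ 1)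
    (hD : IsOpen D) (hd : ContDiffOn ℝ ∞ d D) (hOD : ∀ y ∈ O, (y.1, y.2.2) ∈ D) {p : Y3 × ℝ} (hp : p ∈ tube O) :
    pd dN (pd dN ((fun q : ℝ × E3 => (U q.1 (q.2 + a) - U q.1 q.2) 2) ∘ shearMap e d)) p =
      (-1 : ℝ) * pd (tg eS) (pd (tg eS) ((fun q : ℝ × E3 => (U q.1 (q.2 + a) - U q.1 q.2) 2) ∘ shearMap e d)) p
        + (1 / (1 - μ p.1.1 p.1.2.2)) * pd (tg eT) ((fun q : ℝ × E3 => (U q.1 (q.2 + a) - U q.1 q.2) 2) ∘ shearMap e d) p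
        + (((1 - μ p.1.1 p.1.2.2) * U p.1.1 (shearPt e d p + a) 2 + 2 * deriv (μ p.1.1) p.1.2.2) / (1 - μ p.1.1 p.1.2.2) ^ 2) *
            pd (tg PoloidalWindowDoorLrcModEntireShearedCoordinates.eZ) ((fun q : ℝ × E3 => (U q.1 (q.2 + a) - U q.1 q.2) 2) ∘ shearMap e d) p
        + ((U p.1.1 (shearPt e d p + a) 0 * e 0 + U p.1.1 (shearPt e d p + a) 1 * e 1) / (1 - μ p.1.1 p.1.2.2)) *
            pd (tg eS) ((fun q : ℝ × E3 => (U q.1 (q.2 + a) - U q.1 q.2) 2) ∘ shearMap e d) p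
        + (((1 - μ p.1.1 p.1.2.2) * ((U p.1.1 (shearPt e d p + a) 1 * e 0 - U p.1.1 (shearPt e d p + a) 0 * e 1)
              - fderiv ℝ d (p.1.1, p.1.2.2) ((1 : ℝ), (0 : ℝ)) - U p.1.1 (shearPt e d p + a) 2 * fderiv ℝ d (p.1.1, p.1.2.2) ((0 : ℝ), (1 : ℝ)))
              - 2 * deriv (μ p.1.1) p.1.2.2 * fderiv ℝ d (p.1.1, p.1.2.2) ((0 : ℝ), (1 : ℝ))) / (1 - μ p.1.1 p.1.2.2) ^ 2) *
            pd dN ((fun q : ℝ × E3 => (U q.1 (q.2 + a) - U q.1 q.2) 2) ∘ shearMap e d) p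
        + (((1 - μ p.1.1 p.1.2.2) * fderiv ℝ (U p.1.1) (shearPt e d p) e2 2
              - ((deriv (fun s => μ s p.1.2.2) p.1.1 - deriv (deriv (μ p.1.1)) p.1.2.2)
                  + deriv (μ p.1.1) p.1.2.2 / 2 * (U p.1.1 (shearPt e d p + a) 2 + U p.1.1 (shearPt e d p) 2)))
              / (1 - μ p.1.1 p.1.2.2) ^ 2) * ((fun q : ℝ × E3 => (U q.1 (q.2 + a) - U q.1 q.2) 2) ∘ shearMap e d) p
        + (fderiv ℝ (U p.1.1) (shearPt e d p) e 2 / (1 - μ p.1.1 p.1.2.2)) *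
            ((fun q : ℝ × E3 => ⟪e, U q.1 (q.2 + a) - U q.1 q.2⟫_ℝ) ∘ shearMap e d) p
        + (fderiv ℝ (U p.1.1) (shearPt e d p) (Jvec e) 2 / (1 - μ p.1.1 p.1.2.2)) *
            ((fun q : ℝ × E3 => ⟪Jvec e, U q.1 (q.2 + a) - U q.1 q.2⟫_ℝ) ∘ shearMap e d) p := by
  have h := differenceRow_sheared hrate hcont hmild hdiv hpol hμ3 hslabU he2 hunit ha hO hOt hD hd hOD hp
  have hF : (fun q : ℝ × E3 => U q.1 (q.2 + a) 2 - U q.1 q.2 2) = (fun q : ℝ × E3 => (U q.1 (q.2 + a) - U q.1 q.2) 2) := by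
    funext q; simp
  rw [hF] at h
  -- the `θ`-derivatives as components of the vector derivative
  have hA := isTypeIAncientMild_of_class hrate hcont hmild hdiv
  have hUd : DifferentiableAt ℝ (U p.1.1) (shearPt e d p) := ((hA.contDiff_slice (hOt p.1 hp).1).differentiable (by simp)) _
  have hcoord : ∀ w : E3, fderiv ℝ (fun y : E3 => U p.1.1 y 2) (shearPt e d p) w = fderiv ℝ (U p.1.1) (shearPt e d p) w 2 := by
    intro w
    have hc := ((EuclideanSpace.proj (𝕜 := ℝ) (2 : Fin 3)).hasFDerivAt.comp (shearPt e d p) hUd.hasFDerivAt).fderiv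
    have e3 : (⇑(EuclideanSpace.proj (𝕜 := ℝ) (2 : Fin 3)) ∘ U p.1.1) = fun y => U p.1.1 y 2 := by funext y'; simp
    rw [e3] at hc
    rw [hc]; rfl
  rw [hcoord e, hcoord (Jvec e), hcoord e2] at h
  have hν : (1 - μ p.1.1 p.1.2.2) ≠ 0 := sub_ne_zero.2 (Ne.symm (hμ1 p.1 hp))
  exact solve_template hν h

/-- The components of the TRANSLATED profile `U(t, · + a)` at the sheared point are smooth on the tube. -/
theorem contDiffOn_Ua_comp (hT : IsOpen T) (hW : ContDiffOn ℝ ∞ (uncurry U) (T ×ˢ (univ : Set E3))) (hOT : ∀ y ∈ O, y.1 ∈ T)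
    (hD : IsOpen D) (hd : ContDiffOn ℝ ∞ d D) (hOD : ∀ y ∈ O, (y.1, y.2.2) ∈ D) (a : E3) (i : Fin 3) :
    ContDiffOn ℝ ∞ (fun p : Y3 × ℝ => U p.1.1 (shearPt e d p + a) i) (tube O) := by
  have hshift : ContDiffOn ℝ ∞ (fun q : ℝ × E3 => uncurry U (q.1, q.2 + a)) (T ×ˢ (univ : Set E3)) := by
    refine hW.comp ((contDiff_fst.prodMk (contDiff_snd.add contDiff_const)).contDiffOn) ?_
    intro q hq
    exact mem_prod.2 ⟨(mem_prod.1 hq).1, mem_univ _⟩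
  have hF : ContDiffOn ℝ ∞ (fun q : ℝ × E3 => uncurry U (q.1, q.2 + a) i) (T ×ˢ (univ : Set E3)) :=
    (EuclideanSpace.proj (𝕜 := ℝ) i).contDiff.comp_contDiffOn hshift
  have h := contDiffOn_comp_shearMap (e := e) (F := fun q : ℝ × E3 => uncurry U (q.1, q.2 + a) i) hT hF hOT hD hd hOD
  exact h.congr fun p _ => by simp [shearMap]

/-- ★ **The coefficients `α₂, …, α₈` of `differenceRow_template` are `C^∞` on the tube** (`α₁ = −1` is constant). -/
theorem difference_coeffs_smooth (hT : IsOpen T) (hW : ContDiffOn ℝ ∞ (uncurry U) (T ×ˢ (univ : Set E3))) (hOT : ∀ y ∈ O, y.1 ∈ T)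
    (hDμ : IsOpen Dμ) (hμs : ContDiffOn ℝ ∞ (uncurry μ) Dμ) (hOμ : ∀ y ∈ O, (y.1, y.2.2) ∈ Dμ) (hμ1 : ∀ y ∈ O, μ y.1 y.2.2 ≠ 1)
    (hD : IsOpen D) (hd : ContDiffOn ℝ ∞ d D) (hOD : ∀ y ∈ O, (y.1, y.2.2) ∈ D) :
    ContDiffOn ℝ ∞ (fun p : Y3 × ℝ => 1 / (1 - μ p.1.1 p.1.2.2)) (tube O) ∧
    ContDiffOn ℝ ∞ (fun p : Y3 × ℝ =>
      ((1 - μ p.1.1 p.1.2.2) * U p.1.1 (shearPt e d p + a) 2 + 2 * deriv (μ p.1.1) p.1.2.2) / (1 - μ p.1.1 p.1.2.2) ^ 2) (tube O) ∧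
    ContDiffOn ℝ ∞ (fun p : Y3 × ℝ =>
      (U p.1.1 (shearPt e d p + a) 0 * e 0 + U p.1.1 (shearPt e d p + a) 1 * e 1) / (1 - μ p.1.1 p.1.2.2)) (tube O) ∧
    ContDiffOn ℝ ∞ (fun p : Y3 × ℝ =>
      ((1 - μ p.1.1 p.1.2.2) * ((U p.1.1 (shearPt e d p + a) 1 * e 0 - U p.1.1 (shearPt e d p + a) 0 * e 1)
          - fderiv ℝ d (p.1.1, p.1.2.2) ((1 : ℝ), (0 : ℝ)) - U p.1.1 (shearPt e d p + a) 2 * fderiv ℝ d (p.1.1, p.1.2.2) ((0 : ℝ), (1 : ℝ)))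
        - 2 * deriv (μ p.1.1) p.1.2.2 * fderiv ℝ d (p.1.1, p.1.2.2) ((0 : ℝ), (1 : ℝ))) / (1 - μ p.1.1 p.1.2.2) ^ 2) (tube O) ∧
    ContDiffOn ℝ ∞ (fun p : Y3 × ℝ =>
      ((1 - μ p.1.1 p.1.2.2) * fderiv ℝ (U p.1.1) (shearPt e d p) e2 2
        - ((deriv (fun s => μ s p.1.2.2) p.1.1 - deriv (deriv (μ p.1.1)) p.1.2.2)
            + deriv (μ p.1.1) p.1.2.2 / 2 * (U p.1.1 (shearPt e d p + a) 2 + U p.1.1 (shearPt e d p) 2)))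
        / (1 - μ p.1.1 p.1.2.2) ^ 2) (tube O) ∧
    ContDiffOn ℝ ∞ (fun p : Y3 × ℝ => fderiv ℝ (U p.1.1) (shearPt e d p) e 2 / (1 - μ p.1.1 p.1.2.2)) (tube O) ∧
    ContDiffOn ℝ ∞ (fun p : Y3 × ℝ => fderiv ℝ (U p.1.1) (shearPt e d p) (Jvec e) 2 / (1 - μ p.1.1 p.1.2.2)) (tube O) := by
  obtain ⟨hμ0, hμz, hμzz, hμt⟩ := contDiffOn_slope (O := O) hDμ hμs hOμ
  have hU := fun i => contDiffOn_U_comp (e := e) hT hW hOT hD hd hOD i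
  have hUa := fun i => contDiffOn_Ua_comp (e := e) hT hW hOT hD hd hOD a i
  have hdU := fun v => contDiffOn_dU_comp (e := e) hT hW hOT hD hd hOD v
  have hdz := contDiffOn_dd (O := O) hD hd hOD ((0 : ℝ), (1 : ℝ))
  have hdt := contDiffOn_dd (O := O) hD hd hOD ((1 : ℝ), (0 : ℝ))
  have hν : ContDiffOn ℝ ∞ (fun p : Y3 × ℝ => 1 - μ p.1.1 p.1.2.2) (tube O) := contDiffOn_const.sub hμ0
  have hν0 : ∀ p ∈ tube O, (1 - μ p.1.1 p.1.2.2) ≠ 0 := fun p hp => sub_ne_zero.2 (Ne.symm (hμ1 p.1 hp))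
  have hν2 : ContDiffOn ℝ ∞ (fun p : Y3 × ℝ => (1 - μ p.1.1 p.1.2.2) ^ 2) (tube O) := hν.pow 2
  have hν20 : ∀ p ∈ tube O, (1 - μ p.1.1 p.1.2.2) ^ 2 ≠ 0 := fun p hp => pow_ne_zero 2 (hν0 p hp)
  have hc : ∀ c : ℝ, ContDiffOn ℝ ∞ (fun _ : Y3 × ℝ => c) (tube O) := fun c => contDiffOn_const
  refine ⟨(hc 1).div hν hν0, ?_, ?_, ?_, ?_, (hdU e).div hν hν0, (hdU (Jvec e)).div hν hν0⟩
  · exact ((hν.mul (hUa 2)).add ((hc 2).mul hμz)).div hν2 hν20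
  · exact (((hUa 0).mul (hc _)).add ((hUa 1).mul (hc _))).div hν hν0
  · exact ((hν.mul ((((hUa 1).mul (hc _)).sub ((hUa 0).mul (hc _))).sub hdt |>.sub ((hUa 2).mul hdz))).sub
      (((hc 2).mul hμz).mul hdz)).div hν2 hν20
  · exact ((hν.mul (hdU e2)).sub ((hμt.sub hμzz).add (((hμz.div (hc 2) (fun _ _ => two_ne_zero))).mul ((hUa 2).add (hU 2))))).div hν2 hν20

end Summit.NavierStokesRegularity.NavierStokesRegularity.Theorems.PoloidalWindowDoorLrcModEntireShearedDifferenceTemplate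

end
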